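import Mathlib
import HarnessLib
import Literature.Computability.AlgebraicComplexity.MignonRessayreBound
import Summits.PneNP.PneNP.Theorems.CnfIdealGenLengthRankDefectRepresentationsCutLemmaCharacterCuts

/-!
# Character covers: the cut lemma with constant `≤ n` for affinely separated colour classes
# (line rank-dehn-ladder, stub `stub_cutLemma`)

Crux `stmt-PneNP-18923` (`Summit.PneNP.PneNP.Theses.CnfIdealGenLength.RankDefectRepresentations`), line `rank-dehn-ladder`,
negative rung N1 = `stub_cutLemma` (OPEN).  Rows `x : ι`, columns `y : ι'` carry colours `row x, col y : Fin n → Bool`; the `j`-th cut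
of `R` is `R ∘ 1[row_j ≠ col_j]`.

`…CutLemmaCharacterCuts.rank_submatrix_characterSeparated_le` (lead g2): a rectangle all of whose row/column colour pairs differ at
an ODD number of places of one coordinate set `T` has rank `≤ ∑_{j∈T} rank cut_j`.  THIS FILE: if the columns are COVERED by `r` such
characters — every column `y` admits some `T_l` (`l < r`) separating it from ALL rows — then, splitting the columns by the first
separating character,

  `rank R ≤ ∑_{l<r} ∑_{j ∈ T_l} rank cut_j ≤ r · n · t`     (`rank_le_of_characterCover`, `rank_le_mul_of_characterCover`).

WHEN DOES A COVER EXIST (remark, not formalised): characters constant on the row colours `S` are the parity checks `T` vanishing on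
the linear span of `S − S` over `F_2`; a column colour `τ` is separated by one of them iff `τ ∉ aff_{F_2}(S)`, the affine hull of the
row colours.  Hence: if NO column colour lies in the `F_2`-affine hull of the row colours (or, transposing, vice versa), the
colour-disjoint core of `stub_cutLemma` holds with constant `r ≤ codim aff(S) ≤ n` — and `r ≤ ⌈log₂(#S' + 1)⌉` by a random choice of
checks.  Examples: rows in a subgroup `H`, columns in any union of other cosets (lead g6's translation-invariant theorem,
`Lines/rank-dehn-ladder-A-problem.md` §9, thereby holds for ARBITRARY data); even-weight rows against odd-weight columns (`r = 1`).
What remains of N1 after this file is the AFFINELY ENTANGLED core: `S' ∩ aff(S) ≠ ∅ ≠ S ∩ aff(S')` (e.g. random colourings, where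
both hulls are everything).
HONEST FRAMING: one more proved regime of one rung; the cut lemma, the crux and P ≠ NP are not touched; F-N2 is a FRONTIER formal rung.
-/

set_option linter.dupNamespace false -- `Summit.PneNP.PneNP.…`: summit = sub-problem name (D-0017)

namespace Summit.PneNP.PneNP.Theorems.CnfIdealGenLengthRankDefectRepresentationsCutLemmaCharacterCover

open Finset
open Literature.Computability.AlgebraicComplexity (rank_sum_le)
open Summit.PneNP.PneNP.Theorems.CnfIdealGenLengthRankDefectRepresentationsCutLemmaCharacterCuts
  (rank_submatrix_characterSeparated_le)

variable {K : Type} [Field K] {n : ℕ} {ι ι' : Type} [Fintype ι] [Fintype ι'] [DecidableEq ι] [DecidableEq ι']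

omit [Fintype ι] [DecidableEq ι] in
/-- Restricting a matrix to a set of columns (zero elsewhere) costs at most the rank of the corresponding column submatrix. -/
theorem rank_colRestrict_le (R : Matrix ι ι' K) (C : Finset ι') :
    (Matrix.of fun x y => if y ∈ C then R x y else 0).rank ≤ (R.submatrix id (Subtype.val : {y // y ∈ C} → ι')).rank := by
  have h : (Matrix.of fun x y => if y ∈ C then R x y else 0) =
      R.submatrix id (Subtype.val : {y // y ∈ C} → ι') *
        (Matrix.of fun (c : {y // y ∈ C}) (y : ι') => if (c : ι') = y then (1 : K) else 0) := by
    ext x y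
    simp only [Matrix.of_apply, Matrix.mul_apply, Matrix.submatrix_apply, id_eq, mul_ite, mul_one, mul_zero]
    by_cases hy : y ∈ C
    · rw [if_pos hy]
      rw [Finset.sum_eq_single ⟨y, hy⟩]
      · simp
      · intro c _ hc
        rw [if_neg]
        exact fun h => hc (Subtype.ext h)
      · intro h; exact absurd (Finset.mem_univ _) h
    · rw [if_neg hy]
      refine (Finset.sum_eq_zero fun c _ => ?_).symm
      rw [if_neg]
      intro h; exact hy (h ▸ c.2)
  rw [h]
  exact Matrix.rank_mul_le_left _ _

/-- **CHARACTER COVER.**  If every column `y` is separated from ALL rows by one of the characters `χ_{T_l}` (`l < r`) — i.e. its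
colour differs from every row colour at an odd number of places of `T_l` — then
`rank R ≤ ∑_{l<r} ∑_{j∈T_l} rank (cut_j R)`. -/
theorem rank_le_of_characterCover (row : ι → Fin n → Bool) (col : ι' → Fin n → Bool) (R : Matrix ι ι' K) {r : ℕ}
    (T : Fin r → Finset (Fin n))
    (hcov : ∀ y : ι', ∃ l : Fin r, ∀ x : ι, Odd ((T l).filter fun j => row x j ≠ col y j).card) :
    R.rank ≤ ∑ l : Fin r, ∑ j ∈ T l, (Matrix.of fun x y => if row x j ≠ col y j then R x y else 0).rank := by
  classical
  choose lab hlab using hcov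
  -- split the columns by their label
  have hsplit : R = ∑ l : Fin r, Matrix.of fun x y => if y ∈ Finset.univ.filter (fun y => lab y = l) then R x y else 0 := by
    ext x y
    rw [Matrix.sum_apply]
    simp only [Matrix.of_apply, Finset.mem_filter, Finset.mem_univ, true_and]
    rw [Finset.sum_ite_eq, if_pos (Finset.mem_univ _)]
  have hR : R.rank = (∑ l : Fin r, Matrix.of fun x y =>
      if y ∈ Finset.univ.filter (fun y => lab y = l) then R x y else 0).rank := congrArg Matrix.rank hsplit
  rw [hR]
  refine (rank_sum_le _ _).trans (Finset.sum_le_sum fun l _ => ?_)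
  refine (rank_colRestrict_le R _).trans ?_
  refine rank_submatrix_characterSeparated_le row col R (T l) id
    (Subtype.val : {y // y ∈ Finset.univ.filter (fun y => lab y = l)} → ι') fun x c => ?_
  have hc : lab (c : ι') = l := by
    have := c.2; simp only [Finset.mem_filter, Finset.mem_univ, true_and] at this; exact this
  simpa [hc] using hlab (c : ι') x

/-- Uniform version: with all cuts of rank `≤ t`, a character cover of size `r` gives `rank R ≤ r · (n · t)`.  For rows coloured in
a subgroup (or any affine subspace) of `{0,1}^n` and columns outside it one can take `r ≤ n` (see the module docstring). -/
theorem rank_le_mul_of_characterCover (row : ι → Fin n → Bool) (col : ι' → Fin n → Bool) (R : Matrix ι ι' K) {r : ℕ}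
    (T : Fin r → Finset (Fin n))
    (hcov : ∀ y : ι', ∃ l : Fin r, ∀ x : ι, Odd ((T l).filter fun j => row x j ≠ col y j).card) (t : ℕ)
    (ht : ∀ j : Fin n, (Matrix.of fun x y => if row x j ≠ col y j then R x y else 0).rank ≤ t) :
    R.rank ≤ r * (n * t) := by
  refine (rank_le_of_characterCover row col R T hcov).trans ?_
  calc ∑ l : Fin r, ∑ j ∈ T l, (Matrix.of fun x y => if row x j ≠ col y j then R x y else 0).rank
      ≤ ∑ _l : Fin r, n * t := Finset.sum_le_sum fun l _ => by
        calc ∑ j ∈ T l, (Matrix.of fun x y => if row x j ≠ col y j then R x y else 0).rank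
            ≤ ∑ j ∈ (Finset.univ : Finset (Fin n)), (Matrix.of fun x y => if row x j ≠ col y j then R x y else 0).rank :=
              Finset.sum_le_sum_of_subset (Finset.subset_univ _)
          _ ≤ ∑ _j ∈ (Finset.univ : Finset (Fin n)), t := Finset.sum_le_sum fun j _ => ht j
          _ = n * t := by simp
    _ = r * (n * t) := by simp

/-! ## Character partitions (rows AND columns split) -/

omit [Fintype ι'] [DecidableEq ι'] in
/-- Restricting a matrix to a set of rows (zero elsewhere) costs at most the rank of the corresponding row submatrix. -/
theorem rank_rowRestrict_le [Fintype ι'] {p : ℕ} (R : Matrix ι ι' K) (D : ι → Fin p) (k : Fin p) :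
    (Matrix.of fun x y => if D x = k then R x y else 0).rank ≤
      (R.submatrix (Subtype.val : {x // D x = k} → ι) id).rank := by
  have h : (Matrix.of fun x y => if D x = k then R x y else 0) =
      (Matrix.of fun (x : ι) (c : {x // D x = k}) => if x = (c : ι) then (1 : K) else 0) *
        R.submatrix (Subtype.val : {x // D x = k} → ι) id := by
    ext x y
    simp only [Matrix.of_apply, Matrix.mul_apply, Matrix.submatrix_apply, id_eq, ite_mul, one_mul, zero_mul]
    by_cases hx : D x = k
    · rw [if_pos hx, Finset.sum_eq_single ⟨x, hx⟩]
      · simp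
      · intro c _ hc
        rw [if_neg]
        exact fun h => hc (Subtype.ext h.symm)
      · intro h; exact absurd (Finset.mem_univ _) h
    · rw [if_neg hx]
      refine (Finset.sum_eq_zero fun c _ => ?_).symm
      rw [if_neg]
      intro h; exact hx (h ▸ c.2)
  rw [h]
  exact Matrix.rank_mul_le_right _ _

/-- **CHARACTER PARTITION.**  Split the rows into classes `D⁻¹(k)` and the columns into classes `C⁻¹(l)`; if every block
`D⁻¹(k) × C⁻¹(l)` is separated by a character `χ_{T k l}` (all its colour pairs differ at an odd number of places of `T k l`), then
`rank R ≤ ∑_k ∑_l ∑_{j ∈ T k l} rank (cut_j R)` — at most (number of blocks) · `∑_j rank cut_j`.  The least number of blocks of such a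
partition (the character-partition number of the colour pair) thus controls the constant in N1's RECT core. -/
theorem rank_le_of_characterPartition (row : ι → Fin n → Bool) (col : ι' → Fin n → Bool) (R : Matrix ι ι' K) {p r : ℕ}
    (D : ι → Fin p) (C : ι' → Fin r) (T : Fin p → Fin r → Finset (Fin n))
    (hsep : ∀ x y, Odd ((T (D x) (C y)).filter fun j => row x j ≠ col y j).card) :
    R.rank ≤ ∑ k : Fin p, ∑ l : Fin r, ∑ j ∈ T k l, (Matrix.of fun x y => if row x j ≠ col y j then R x y else 0).rank := by
  classical
  -- split the rows by class
  have hsplit : R = ∑ k : Fin p, Matrix.of fun x y => if D x = k then R x y else 0 := by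
    ext x y
    rw [Matrix.sum_apply]
    simp only [Matrix.of_apply]
    rw [Finset.sum_ite_eq, if_pos (Finset.mem_univ _)]
  have hR : R.rank = (∑ k : Fin p, Matrix.of fun x y => if D x = k then R x y else 0).rank := congrArg Matrix.rank hsplit
  rw [hR]
  refine (rank_sum_le _ _).trans (Finset.sum_le_sum fun k _ => ?_)
  refine (rank_rowRestrict_le R D k).trans ?_
  -- the row class `k` against all columns: a character cover indexed by the column classes
  have hk := rank_le_of_characterCover (row ∘ (Subtype.val : {x // D x = k} → ι)) col
    (R.submatrix (Subtype.val : {x // D x = k} → ι) id) (T k) (fun y => ⟨C y, fun x => by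
      have := hsep (x : ι) y
      rw [x.2] at this
      simpa using this⟩)
  refine hk.trans (Finset.sum_le_sum fun l _ => Finset.sum_le_sum fun j _ => ?_)
  have hcut : (Matrix.of fun (x : {x // D x = k}) y => if (row ∘ Subtype.val) x j ≠ col y j
      then R.submatrix (Subtype.val : {x // D x = k} → ι) id x y else 0) =
      (Matrix.of fun x y => if row x j ≠ col y j then R x y else 0).submatrix (Subtype.val : {x // D x = k} → ι) id := by
    ext x y; simp [Matrix.submatrix_apply]
  rw [hcut]
  exact Summit.PneNP.PneNP.Theorems.CnfIdealGenLengthRankDefectRepresentationsCutLemmaCharacterCuts.rank_submatrix_le' _ _ _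

/-! ## Parity checks: rows inside an affine subspace, columns outside -/

/-- Parity of the number of disagreements on `T` = parity of the two individual `T`-weights. -/
theorem card_filter_ne_mod_two (T : Finset (Fin n)) (r c : Fin n → Bool) :
    (T.filter fun j => r j ≠ c j).card % 2 = ((T.filter fun j => r j = true).card + (T.filter fun j => c j = true).card) % 2 := by
  classical
  induction T using Finset.induction_on with
  | empty => simp
  | insert j T hj ih =>
    rw [Finset.filter_insert, Finset.filter_insert, Finset.filter_insert]
    have hj1 : j ∉ T.filter fun j => r j ≠ c j := fun h => hj (Finset.mem_of_mem_filter _ h)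
    have hj2 : j ∉ T.filter fun j => r j = true := fun h => hj (Finset.mem_of_mem_filter _ h)
    have hj3 : j ∉ T.filter fun j => c j = true := fun h => hj (Finset.mem_of_mem_filter _ h)
    cases hr : r j <;> cases hc : c j <;>
      simp only [ne_eq, Bool.false_eq_true, Bool.true_eq_false, not_false_eq_true, not_true_eq_false,
        if_true, if_false, Finset.card_insert_of_notMem hj1, Finset.card_insert_of_notMem hj2,
        Finset.card_insert_of_notMem hj3] at ih ⊢ <;> omega

/-- **PARITY-CHECK FORM.**  If all row colours satisfy the parity checks `P i` with values `a i` (`i < c`; i.e. the rows lie in an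
affine subspace of `{0,1}^n` cut out by `c` checks) and every column colour violates at least one of them (lies outside that subspace),
then `rank R ≤ c · (n · t)`.  E.g. rows coloured in a subgroup `H` of codimension `c`, columns in the other cosets. -/
theorem rank_le_of_parityChecks (row : ι → Fin n → Bool) (col : ι' → Fin n → Bool) (R : Matrix ι ι' K) {c : ℕ}
    (P : Fin c → Finset (Fin n)) (a : Fin c → ℕ)
    (hrow : ∀ i x, ((P i).filter fun j => row x j = true).card % 2 = a i % 2)
    (hcol : ∀ y, ∃ i, ((P i).filter fun j => col y j = true).card % 2 ≠ a i % 2) (t : ℕ)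
    (ht : ∀ j : Fin n, (Matrix.of fun x y => if row x j ≠ col y j then R x y else 0).rank ≤ t) :
    R.rank ≤ c * (n * t) := by
  refine rank_le_mul_of_characterCover row col R P (fun y => ?_) t ht
  obtain ⟨i, hi⟩ := hcol y
  refine ⟨i, fun x => ?_⟩
  rw [Nat.odd_iff, card_filter_ne_mod_two, Nat.add_mod, hrow i x]
  have h2 := Nat.mod_two_eq_zero_or_one (((P i).filter fun j => col y j = true).card)
  have h3 := Nat.mod_two_eq_zero_or_one (a i)
  omega

end Summit.PneNP.PneNP.Theorems.CnfIdealGenLengthRankDefectRepresentationsCutLemmaCharacterCover
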